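import Summits.BirchSwinnertonDyer.BirchSwinnertonDyer.Theorems.PrintCFramBottomClassIndexLawFiveLeFlipRungFourierMoment
import HarnessLib

/-!
# Crux `PrintCFram.BottomClassIndexLawFiveLe` (stmt-BirchSwinnertonDyer-20372), line `eisenstein-resource-bdp-line`,
# registry v28/v29 — «T8 = THE LOWER-UNIPOTENT RUNG» (Raum 2023 Prop. 2.3 in the kernel), piece T8-1a:
# THE ANALYTIC WEIGHT `W_t(n)` OF THE LOWER-UNIPOTENT RUNG (w3 g19 blueprint (U3))
# (cell `bsd-print-cfram`, width seat `bsd-line-cfram-p1-w6` g9; THEOREMS ONLY, `--supports` 20372; BSD is not proved by any of this)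

HONEST FRAMING. Finite Fourier analysis on `ℤ/q²ℤ` only; nothing here is a statement about modular forms, Bernoulli numbers
or BSD; no registered stub is closed. Context: the odd analytic residue of registry v28 («a prime `q ∣ m` with
`q ≡ −1 (mod 4p)`») is closed in print by M. Raum, *Relations among Ramanujan-type congruences II*, Forum Math. 35 (2023),
Prop. 2.3 (w2 g15's finding; typed statement-only as `Literature.NumberTheory.ModularForms.Raum2023.prop23_…`), whose
device is the LOWER UNIPOTENT `γ_t ≡ [1 0; t 1]` acting on the single-class twist
`V_β = q⁻² ∑_{h mod q²} e(−βh/q²) F₀(· + h/q²)`: after the matrix factorisation `τ(h/q²)·γ_t = δ_h·τ(h'/q²)`,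
`(1 + t h)·h' ≡ h (mod q²)` (T8-2/3, w5 g8), the coefficient of `e(nz)` at the new cusp carries the weight
`W_t(n) = q⁻² ∑_{h : 1+th unit} ψ_{q²}(−β h)·ψ_{q²}(n h')` (crux notes `Lines/eisenstein-resource-bdp-line-w3g19-notes.md` §2 (U3)).
This file EVALUATES that weight (the `q⁻²` is left outside, as in T3):

* §1 bookkeeping in `ZMod (q²)`: `q·q = 0`, `(1 + qy)(1 − qy) = 1`, `q·(unit) ≠ 0`, `ψ_{q²}(q·z) = ψ_q(π z)`
  (`stdAddChar_natCast_mul`), `π(x⁻¹) = (π x)⁻¹` and `π x ≠ 0` for units (`π : ZMod (q²) → ZMod q` the reduction).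
* §2 **`sum_units_stdAddChar_degenerate_eq_zero`** (W1): for `a = q·a₁` and a UNIT `b`, `∑_{x unit} ψ_{q²}(a x + b x⁻¹) = 0`
  (average over `x ↦ x(1 + qy)`); **`sum_units_stdAddChar_degenerate_eq_mul`** (W2): for `a = q·a₁`, `b = q·b₁`,
  `∑_{x unit} ψ_{q²}(a x + b x⁻¹) = q·∑_{x₀ ≠ 0} ψ_q(ā₁ x₀ + b̄₁ x₀⁻¹)` (via T1's `sum_sq_periodic_mul_stdAddChar_of_dvd`).
* §3 **`sum_lowerUnipotent_substitution`** (W0): `x = 1 + t h` turns `∑_{h} ψ(−βh)ψ(n h')` into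
  `ψ(t⁻¹(β + n))·∑_{x unit} ψ(−t⁻¹β·x − t⁻¹n·x⁻¹)`; hence with `β = q·v`: **`lowerUnipotentMoment_eq_zero`** (`q ∤ n`: the
  weight vanishes) and **`lowerUnipotentMoment_eq_kloosterman`** (`n = q·u`: the weight is
  `ψ_{q²}(t⁻¹(β + n)) · q · K_s(ū, v̄)`, `s = −π(t⁻¹)`, with the Kloosterman sum spelled EXACTLY as in w3 g19's
  `…FlipRungLowerUnipotentWeight` (p710371): `∑ x₀ : ZMod q, (if x₀ = 0 then 0 else ψ_q(s * (u * x₀⁻¹ + v * x₀)))`).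
* §4 the same two statements in the INTEGER shape of T8-2/3 (w5 g8's `S'(n)` binder: index condition `q ∤ 1 + j·C`,
  `(1 + j·C)·h'_j = j + q²·e_j`, phase `cexp(2πi (h'_j/q²) n)`): `isUnit_intCast_of_not_dvd`,
  **`lowerUnipotentMoment_cexp_eq_zero_of_not_dvd`**, **`lowerUnipotentMoment_cexp_mul_eq`**.

Downstream (not here): NF-Q at the cusps `γ_t` (T4, w3 g19), the rational trace `∑_s ψ(−sj) K_s = q·c_j − (q−1)` and the
pigeonhole (w3 g19 p710371), the assembly (w8 g9). References: Raum 2023 §2.2 (arXiv:2105.13170 pp. 20–24); crux notes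
w3g19 §2; LEAD g14 crux notes §2. beyond-print theorem: NO.
-/

set_option autoImplicit false
-- summit-side namespace `Summit.BirchSwinnertonDyer.BirchSwinnertonDyer.…` (single-conjunct summit, D-0017 layout)
set_option linter.dupNamespace false

noncomputable section

open scoped NumberTheorySymbols Real
open Complex Finset

namespace Summit.BirchSwinnertonDyer.BirchSwinnertonDyer.Theorems.PrintCFram.FlipRung

section LowerUnipotent

variable (q : ℕ) [Fact q.Prime]

omit [Fact q.Prime] in
/-- In `ZMod (q²)`: `q · q = 0`. -/
theorem natCast_mul_natCast_sq_eq_zero : (q : ZMod (q ^ 2)) * (q : ZMod (q ^ 2)) = 0 := by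
  rw [← Nat.cast_mul, ← pow_two, ZMod.natCast_self]

omit [Fact q.Prime] in
/-- In `ZMod (q²)`: `1 + q·y` is a unit with inverse `1 − q·y`. -/
theorem one_add_natCast_mul_mul_one_sub (y : ZMod (q ^ 2)) :
    (1 + (q : ZMod (q ^ 2)) * y) * (1 - (q : ZMod (q ^ 2)) * y) = 1 := by
  have h := natCast_mul_natCast_sq_eq_zero q
  linear_combination (-(y * y)) * h

/-- In `ZMod (q²)`: a unit times `q` is non-zero. -/
theorem natCast_mul_ne_zero_of_isUnit {w : ZMod (q ^ 2)} (hw : IsUnit w) : (q : ZMod (q ^ 2)) * w ≠ 0 := by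
  intro h
  obtain ⟨u, rfl⟩ := hw
  have h2 : (q : ZMod (q ^ 2)) = 0 := by
    have := congrArg (fun z ↦ z * ((u⁻¹ : (ZMod (q ^ 2))ˣ) : ZMod (q ^ 2))) h
    simpa [mul_assoc] using this
  rw [ZMod.natCast_eq_zero_iff] at h2
  have hq := (Fact.out : q.Prime).two_le
  have : q ^ 2 ≤ q := Nat.le_of_dvd (by omega) h2
  nlinarith

/-- `ψ_{q²}(q·z) = ψ_q(π z)` for the reduction `π : ZMod (q²) → ZMod q`. -/
theorem stdAddChar_natCast_mul (z : ZMod (q ^ 2)) :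
    ZMod.stdAddChar ((q : ZMod (q ^ 2)) * z) =
      ZMod.stdAddChar (ZMod.castHom (dvd_pow_self q two_ne_zero) (ZMod q) z) := by
  have h := stdAddChar_sq_natMul q (z.val : ℤ)
  push_cast at h
  rw [ZMod.natCast_zmod_val] at h
  rw [h, ZMod.castHom_apply, ZMod.cast_eq_val]

/-- The reduction `π : ZMod (q²) → ZMod q` sends the inverse of a unit to the inverse. -/
theorem castHom_units_inv (x : (ZMod (q ^ 2))ˣ) :
    ZMod.castHom (dvd_pow_self q two_ne_zero) (ZMod q) ((x⁻¹ : (ZMod (q ^ 2))ˣ) : ZMod (q ^ 2)) =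
      (ZMod.castHom (dvd_pow_self q two_ne_zero) (ZMod q) (x : ZMod (q ^ 2)))⁻¹ := by
  symm
  apply inv_eq_of_mul_eq_one_left
  rw [← map_mul, Units.inv_mul, map_one]

/-- The reduction of a unit of `ZMod (q²)` is non-zero in `ZMod q`. -/
theorem castHom_units_ne_zero (x : (ZMod (q ^ 2))ˣ) :
    ZMod.castHom (dvd_pow_self q two_ne_zero) (ZMod q) (x : ZMod (q ^ 2)) ≠ 0 := by
  intro h
  have h1 : ZMod.castHom (dvd_pow_self q two_ne_zero) (ZMod q)
      ((x : ZMod (q ^ 2)) * ((x⁻¹ : (ZMod (q ^ 2))ˣ) : ZMod (q ^ 2))) = 1 := by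
    rw [Units.mul_inv, map_one]
  rw [map_mul, h, zero_mul] at h1
  exact zero_ne_one h1

/-- **(W1) The mixed sum vanishes.** For `a = q·a₁` and a UNIT `b` in `ZMod (q²)`:
`∑_{x unit} ψ_{q²}(a·x + b·x⁻¹) = 0` (average over the substitutions `x ↦ x·(1 + q y)`, `(1+qy)⁻¹ = 1 − qy`). -/
theorem sum_units_stdAddChar_degenerate_eq_zero (a₁ : ZMod (q ^ 2)) {b : ZMod (q ^ 2)} (hb : IsUnit b) :
    ∑ x : (ZMod (q ^ 2))ˣ, ZMod.stdAddChar ((q : ZMod (q ^ 2)) * a₁ * (x : ZMod (q ^ 2)) +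
      b * ((x⁻¹ : (ZMod (q ^ 2))ˣ) : ZMod (q ^ 2))) = 0 := by
  classical
  set T := ∑ x : (ZMod (q ^ 2))ˣ, ZMod.stdAddChar ((q : ZMod (q ^ 2)) * a₁ * (x : ZMod (q ^ 2)) +
      b * ((x⁻¹ : (ZMod (q ^ 2))ˣ) : ZMod (q ^ 2))) with hT
  -- the unit `1 + q y`
  have hwy : ∀ y : ZMod (q ^ 2), (1 + (q : ZMod (q ^ 2)) * y) * (1 - (q : ZMod (q ^ 2)) * y) = 1 :=
    one_add_natCast_mul_mul_one_sub q
  let w : ZMod (q ^ 2) → (ZMod (q ^ 2))ˣ := fun y ↦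
    ⟨1 + (q : ZMod (q ^ 2)) * y, 1 - (q : ZMod (q ^ 2)) * y, hwy y, by rw [mul_comm]; exact hwy y⟩
  -- for every y, substituting x ↦ x · w y
  have hsub : ∀ y : ZMod (q ^ 2), T = ∑ x : (ZMod (q ^ 2))ˣ,
      ZMod.stdAddChar ((q : ZMod (q ^ 2)) * a₁ * (x : ZMod (q ^ 2)) + b * ((x⁻¹ : (ZMod (q ^ 2))ˣ) : ZMod (q ^ 2))) *
        ZMod.stdAddChar (-((q : ZMod (q ^ 2)) * b * ((x⁻¹ : (ZMod (q ^ 2))ˣ) : ZMod (q ^ 2))) * y) := by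
    intro y
    rw [hT, ← Equiv.sum_comp (Equiv.mulRight (w y))]
    refine Finset.sum_congr rfl fun x _ ↦ ?_
    rw [← AddChar.map_add_eq_mul]
    congr 1
    simp only [Equiv.coe_mulRight, mul_inv_rev, Units.val_mul]
    have hwv : ((w y : (ZMod (q ^ 2))ˣ) : ZMod (q ^ 2)) = 1 + (q : ZMod (q ^ 2)) * y := rfl
    have hwi : (((w y)⁻¹ : (ZMod (q ^ 2))ˣ) : ZMod (q ^ 2)) = 1 - (q : ZMod (q ^ 2)) * y := rfl
    rw [hwv, hwi]
    have h0 := natCast_mul_natCast_sq_eq_zero q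
    linear_combination (a₁ * (x : ZMod (q ^ 2)) * y) * h0
  -- sum over y
  have hsum : (Fintype.card (ZMod (q ^ 2)) : ℂ) * T = ∑ x : (ZMod (q ^ 2))ˣ,
      ZMod.stdAddChar ((q : ZMod (q ^ 2)) * a₁ * (x : ZMod (q ^ 2)) + b * ((x⁻¹ : (ZMod (q ^ 2))ˣ) : ZMod (q ^ 2))) *
        ∑ y : ZMod (q ^ 2), ZMod.stdAddChar (y * -((q : ZMod (q ^ 2)) * b * ((x⁻¹ : (ZMod (q ^ 2))ˣ) : ZMod (q ^ 2)))) := by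
    rw [← Finset.card_univ, ← nsmul_eq_mul, ← Finset.sum_const]
    rw [Finset.sum_congr rfl (fun y _ ↦ hsub y), Finset.sum_comm]
    refine Finset.sum_congr rfl fun x _ ↦ ?_
    rw [Finset.mul_sum]
    exact Finset.sum_congr rfl fun y _ ↦ by rw [mul_comm y]
  have hzero : ∀ x : (ZMod (q ^ 2))ˣ,
      ∑ y : ZMod (q ^ 2), ZMod.stdAddChar (y * -((q : ZMod (q ^ 2)) * b * ((x⁻¹ : (ZMod (q ^ 2))ˣ) : ZMod (q ^ 2)))) = 0 := by
    intro x
    rw [AddChar.sum_mulShift _ (ZMod.isPrimitive_stdAddChar (q ^ 2)), if_neg]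
    · simp
    rw [neg_eq_zero, mul_assoc]
    exact natCast_mul_ne_zero_of_isUnit q (hb.mul (Units.isUnit _))
  simp_rw [hzero, mul_zero, Finset.sum_const_zero] at hsum
  have hcard : (Fintype.card (ZMod (q ^ 2)) : ℂ) ≠ 0 := by
    rw [ZMod.card]; exact Nat.cast_ne_zero.mpr (pow_ne_zero 2 (Fact.out : q.Prime).ne_zero)
  exact (mul_eq_zero.mp hsum).resolve_left hcard

/-- **(W2) The degenerate sum reduces mod `q`.** For `a = q·a₁`, `b = q·b₁` in `ZMod (q²)`:
`∑_{x unit} ψ_{q²}(a·x + b·x⁻¹) = q · ∑_{x₀ ∈ (ZMod q), x₀ ≠ 0} ψ_q(ā₁ x₀ + b̄₁ x₀⁻¹)`. -/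
theorem sum_units_stdAddChar_degenerate_eq_mul (a₁ b₁ : ZMod (q ^ 2)) :
    ∑ x : (ZMod (q ^ 2))ˣ, ZMod.stdAddChar ((q : ZMod (q ^ 2)) * a₁ * (x : ZMod (q ^ 2)) +
      (q : ZMod (q ^ 2)) * b₁ * ((x⁻¹ : (ZMod (q ^ 2))ˣ) : ZMod (q ^ 2))) =
      (q : ℂ) * ∑ x₀ : ZMod q, (if x₀ = 0 then (0 : ℂ) else
        ZMod.stdAddChar (ZMod.castHom (dvd_pow_self q two_ne_zero) (ZMod q) a₁ * x₀ +
          ZMod.castHom (dvd_pow_self q two_ne_zero) (ZMod q) b₁ * x₀⁻¹)) := by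
  classical
  set πq := ZMod.castHom (dvd_pow_self q two_ne_zero) (ZMod q) with hπq
  -- the summand only depends on `π x`
  set G : ZMod q → ℂ := fun x₀ ↦ if x₀ = 0 then (0 : ℂ) else ZMod.stdAddChar (πq a₁ * x₀ + πq b₁ * x₀⁻¹) with hG
  have hx : ∀ x : (ZMod (q ^ 2))ˣ, ZMod.stdAddChar ((q : ZMod (q ^ 2)) * a₁ * (x : ZMod (q ^ 2)) +
      (q : ZMod (q ^ 2)) * b₁ * ((x⁻¹ : (ZMod (q ^ 2))ˣ) : ZMod (q ^ 2))) = G (πq (x : ZMod (q ^ 2))) := by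
    intro x
    rw [hG]
    simp only
    rw [if_neg (castHom_units_ne_zero q x), show (q : ZMod (q ^ 2)) * a₁ * (x : ZMod (q ^ 2)) +
      (q : ZMod (q ^ 2)) * b₁ * ((x⁻¹ : (ZMod (q ^ 2))ˣ) : ZMod (q ^ 2)) =
      (q : ZMod (q ^ 2)) * (a₁ * (x : ZMod (q ^ 2)) + b₁ * ((x⁻¹ : (ZMod (q ^ 2))ˣ) : ZMod (q ^ 2))) by ring,
      stdAddChar_natCast_mul, map_add, map_mul, map_mul, castHom_units_inv]
  simp_rw [hx]
  -- pass to a sum over `ZMod (q²)` with the indicator of units, then to `ZMod q`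
  rw [sum_units_eq_sum_ite (fun x : ZMod (q ^ 2) ↦ G (πq x))]
  set H : ℕ → ℂ := fun m ↦ if q ∣ m then (0 : ℂ) else G (m : ZMod q) with hH
  have hHper : Function.Periodic H q := by
    intro m
    simp only [hH, Nat.dvd_add_self_right]
    push_cast
    rw [ZMod.natCast_self, add_zero]
  have hval : ∀ x : ZMod (q ^ 2), (if IsUnit x then G (πq x) else 0) = H x.val * ZMod.stdAddChar (x * ((((q : ℤ) * 0 : ℤ)) : ZMod (q ^ 2))) := by
    intro x
    rw [mul_zero, Int.cast_zero, mul_zero, AddChar.map_zero_eq_one, mul_one, hH]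
    simp only
    rw [hπq, ZMod.castHom_apply, ZMod.cast_eq_val]
    by_cases hu : IsUnit x
    · rw [if_pos hu, if_neg ((isUnit_iff_not_dvd_val q x).mp hu)]
    · rw [if_neg hu, if_pos (not_not.mp ((isUnit_iff_not_dvd_val q x).not.mp hu))]
  simp_rw [hval]
  rw [sum_sq_periodic_mul_stdAddChar_of_dvd q H hHper 0]
  congr 1
  refine Finset.sum_congr rfl fun x₀ _ ↦ ?_
  rw [Int.cast_zero, mul_zero, AddChar.map_zero_eq_one, mul_one, hH]
  simp only
  rw [ZMod.natCast_zmod_val]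
  by_cases h0 : x₀ = 0
  · rw [if_pos (by rw [h0, ZMod.val_zero]; exact dvd_zero q), hG]
    simp [h0]
  · rw [if_neg (fun h ↦ h0 ((intCast_dvd_val_iff q x₀).mp (by exact_mod_cast h)))]

/-- **(W0) The substitution `x = 1 + t·h`.** For a unit `t`, any `β n : ZMod (q²)` and any `h'` with
`(1 + t h)·h'(h) = h` whenever `1 + t h` is a unit:
`∑_{h, 1+th unit} ψ(−β h)·ψ(n·h'(h)) = ψ(t⁻¹(β + n)) · ∑_{x unit} ψ(−t⁻¹β·x − t⁻¹n·x⁻¹)`. -/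
theorem sum_lowerUnipotent_substitution (t : (ZMod (q ^ 2))ˣ) (β n : ZMod (q ^ 2))
    (h' : ZMod (q ^ 2) → ZMod (q ^ 2))
    (hh' : ∀ h : ZMod (q ^ 2), IsUnit (1 + (t : ZMod (q ^ 2)) * h) → (1 + (t : ZMod (q ^ 2)) * h) * h' h = h) :
    ∑ h : ZMod (q ^ 2), (if IsUnit (1 + (t : ZMod (q ^ 2)) * h) then
        ZMod.stdAddChar (-(β * h)) * ZMod.stdAddChar (n * h' h) else 0) =
      ZMod.stdAddChar (((t⁻¹ : (ZMod (q ^ 2))ˣ) : ZMod (q ^ 2)) * (β + n)) *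
        ∑ x : (ZMod (q ^ 2))ˣ, ZMod.stdAddChar (-(((t⁻¹ : (ZMod (q ^ 2))ˣ) : ZMod (q ^ 2)) * β) * (x : ZMod (q ^ 2)) +
          -(((t⁻¹ : (ZMod (q ^ 2))ˣ) : ZMod (q ^ 2)) * n) * ((x⁻¹ : (ZMod (q ^ 2))ˣ) : ZMod (q ^ 2))) := by
  classical
  set T : ZMod (q ^ 2) := (t : ZMod (q ^ 2)) with hT
  set Ti : ZMod (q ^ 2) := ((t⁻¹ : (ZMod (q ^ 2))ˣ) : ZMod (q ^ 2)) with hTi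
  have hTT : T * Ti = 1 := by rw [hT, hTi, Units.mul_inv]
  -- the affine bijection `h ↦ 1 + t h`
  let e : ZMod (q ^ 2) ≃ ZMod (q ^ 2) :=
    { toFun := fun h ↦ 1 + T * h
      invFun := fun x ↦ Ti * (x - 1)
      left_inv := fun h ↦ by
        show Ti * (1 + T * h - 1) = h
        linear_combination h * hTT
      right_inv := fun x ↦ by
        show 1 + T * (Ti * (x - 1)) = x
        linear_combination (x - 1) * hTT }
  rw [← Equiv.sum_comp e.symm]
  have he : ∀ x : ZMod (q ^ 2), 1 + T * e.symm x = x := fun x ↦ e.apply_symm_apply x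
  have hes : ∀ x : ZMod (q ^ 2), e.symm x = Ti * (x - 1) := fun _ ↦ rfl
  simp_rw [he]
  rw [← sum_units_eq_sum_ite (fun x : ZMod (q ^ 2) ↦
    ZMod.stdAddChar (-(β * e.symm x)) * ZMod.stdAddChar (n * h' (e.symm x))), Finset.mul_sum]
  refine Finset.sum_congr rfl fun x _ ↦ ?_
  rw [← AddChar.map_add_eq_mul, ← AddChar.map_add_eq_mul]
  congr 1
  have hx := hh' (e.symm x) (by rw [he]; exact Units.isUnit x)
  rw [he] at hx
  -- `h' = x⁻¹ · h`
  have hh : h' (e.symm x) = ((x⁻¹ : (ZMod (q ^ 2))ˣ) : ZMod (q ^ 2)) * (Ti * ((x : ZMod (q ^ 2)) - 1)) := by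
    rw [← hes]
    calc h' (e.symm x) = (((x⁻¹ : (ZMod (q ^ 2))ˣ) : ZMod (q ^ 2)) * (x : ZMod (q ^ 2))) * h' (e.symm x) := by
          rw [Units.inv_mul, one_mul]
      _ = ((x⁻¹ : (ZMod (q ^ 2))ˣ) : ZMod (q ^ 2)) * ((x : ZMod (q ^ 2)) * h' (e.symm x)) := by rw [mul_assoc]
      _ = ((x⁻¹ : (ZMod (q ^ 2))ˣ) : ZMod (q ^ 2)) * e.symm x := by rw [hx]
  rw [hh, hes]
  have hxx : ((x⁻¹ : (ZMod (q ^ 2))ˣ) : ZMod (q ^ 2)) * (x : ZMod (q ^ 2)) = 1 := Units.inv_mul x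
  linear_combination (n * Ti) * hxx

/-- **(W3a) The lower-unipotent moment vanishes off the `q`-progression.** With `β = q·v` and `n` a UNIT of
`ZMod (q²)` (i.e. `q ∤ n`): `∑_{h, 1+th unit} ψ(−β h)·ψ(n·h'(h)) = 0`. -/
theorem lowerUnipotentMoment_eq_zero (t : (ZMod (q ^ 2))ˣ) (v : ZMod (q ^ 2)) {n : ZMod (q ^ 2)} (hn : IsUnit n)
    (h' : ZMod (q ^ 2) → ZMod (q ^ 2))
    (hh' : ∀ h : ZMod (q ^ 2), IsUnit (1 + (t : ZMod (q ^ 2)) * h) → (1 + (t : ZMod (q ^ 2)) * h) * h' h = h) :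
    ∑ h : ZMod (q ^ 2), (if IsUnit (1 + (t : ZMod (q ^ 2)) * h) then
        ZMod.stdAddChar (-((q : ZMod (q ^ 2)) * v * h)) * ZMod.stdAddChar (n * h' h) else 0) = 0 := by
  rw [sum_lowerUnipotent_substitution q t _ n h' hh']
  have h1 := sum_units_stdAddChar_degenerate_eq_zero q (-(((t⁻¹ : (ZMod (q ^ 2))ˣ) : ZMod (q ^ 2)) * v))
    (b := -(((t⁻¹ : (ZMod (q ^ 2))ˣ) : ZMod (q ^ 2)) * n)) ((Units.isUnit _).mul hn).neg
  rw [show -(((t⁻¹ : (ZMod (q ^ 2))ˣ) : ZMod (q ^ 2)) * ((q : ZMod (q ^ 2)) * v)) =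
    (q : ZMod (q ^ 2)) * -(((t⁻¹ : (ZMod (q ^ 2))ˣ) : ZMod (q ^ 2)) * v) by ring, h1, mul_zero]

/-- **(W3b) The lower-unipotent moment on the `q`-progression is a Kloosterman sum.** With `β = q·v` and `n = q·u`:
`∑_{h, 1+th unit} ψ_{q²}(−β h)·ψ_{q²}(n·h'(h)) = ψ_{q²}(t⁻¹(β + n)) · q · K_s(ū, v̄)`, `s = −π(t⁻¹)`,
`K_s(u,v) = ∑_{x ≠ 0} ψ_q(s·(u·x⁻¹ + v·x))` (spelling of `…FlipRungLowerUnipotentWeight`), `π : ZMod (q²) → ZMod q`. -/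
theorem lowerUnipotentMoment_eq_kloosterman (t : (ZMod (q ^ 2))ˣ) (v u : ZMod (q ^ 2))
    (h' : ZMod (q ^ 2) → ZMod (q ^ 2))
    (hh' : ∀ h : ZMod (q ^ 2), IsUnit (1 + (t : ZMod (q ^ 2)) * h) → (1 + (t : ZMod (q ^ 2)) * h) * h' h = h) :
    ∑ h : ZMod (q ^ 2), (if IsUnit (1 + (t : ZMod (q ^ 2)) * h) then
        ZMod.stdAddChar (-((q : ZMod (q ^ 2)) * v * h)) * ZMod.stdAddChar ((q : ZMod (q ^ 2)) * u * h' h) else 0) =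
      ZMod.stdAddChar (((t⁻¹ : (ZMod (q ^ 2))ˣ) : ZMod (q ^ 2)) * ((q : ZMod (q ^ 2)) * v + (q : ZMod (q ^ 2)) * u)) *
        ((q : ℂ) * ∑ x₀ : ZMod q, (if x₀ = 0 then (0 : ℂ) else
          ZMod.stdAddChar (-(ZMod.castHom (dvd_pow_self q two_ne_zero) (ZMod q)
              ((t⁻¹ : (ZMod (q ^ 2))ˣ) : ZMod (q ^ 2))) *
            (ZMod.castHom (dvd_pow_self q two_ne_zero) (ZMod q) u * x₀⁻¹ +
              ZMod.castHom (dvd_pow_self q two_ne_zero) (ZMod q) v * x₀)))) := by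
  rw [sum_lowerUnipotent_substitution q t _ _ h' hh']
  congr 1
  have h1 := sum_units_stdAddChar_degenerate_eq_mul q (-(((t⁻¹ : (ZMod (q ^ 2))ˣ) : ZMod (q ^ 2)) * v))
    (-(((t⁻¹ : (ZMod (q ^ 2))ˣ) : ZMod (q ^ 2)) * u))
  rw [show -(((t⁻¹ : (ZMod (q ^ 2))ˣ) : ZMod (q ^ 2)) * ((q : ZMod (q ^ 2)) * v)) =
      (q : ZMod (q ^ 2)) * -(((t⁻¹ : (ZMod (q ^ 2))ˣ) : ZMod (q ^ 2)) * v) by ring,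
    show -(((t⁻¹ : (ZMod (q ^ 2))ˣ) : ZMod (q ^ 2)) * ((q : ZMod (q ^ 2)) * u)) =
      (q : ZMod (q ^ 2)) * -(((t⁻¹ : (ZMod (q ^ 2))ˣ) : ZMod (q ^ 2)) * u) by ring, h1]
  congr 1
  refine Finset.sum_congr rfl fun x₀ _ ↦ ?_
  by_cases h0 : x₀ = 0
  · rw [if_pos h0, if_pos h0]
  · rw [if_neg h0, if_neg h0, map_neg, map_neg, map_mul, map_mul]
    congr 1
    ring

/-! ## §4 The weight in the integer shape of T8-2/3 -/

/-- For `z : ℤ`: `(z : ZMod (q²))` is a unit iff `q ∤ z`. -/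
theorem isUnit_intCast_iff_not_dvd (z : ℤ) : IsUnit ((z : ZMod (q ^ 2))) ↔ ¬ (q : ℤ) ∣ z := by
  rw [isUnit_iff_not_dvd_val]
  have h1 : ((((z : ZMod (q ^ 2))).val : ℤ) : ZMod q) = ((z : ℤ) : ZMod q) := by
    have := map_intCast (ZMod.castHom (dvd_pow_self q two_ne_zero) (ZMod q)) z
    rw [ZMod.castHom_apply, ZMod.cast_eq_val] at this
    exact_mod_cast this
  rw [← ZMod.intCast_zmod_eq_zero_iff_dvd, ← h1, Int.cast_natCast, ZMod.natCast_eq_zero_iff]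

/-- The data of T8-2/3 read in `ZMod (q²)`: with `t = C`, `1 + t·j` is a unit iff `q ∤ 1 + j·C`, and then
`(1 + t·j)·h'_j = j` (from `(1 + j·C)·h'_j = j + q²·e_j`). -/
theorem lowerUnipotent_data_cast (C : ℤ) (h' e : ZMod (q ^ 2) → ℤ)
    (hhe : ∀ j : ZMod (q ^ 2), ¬ (q : ℤ) ∣ 1 + (j.val : ℤ) * C →
      (1 + (j.val : ℤ) * C) * h' j = (j.val : ℤ) + (q : ℤ) ^ 2 * e j) (j : ZMod (q ^ 2)) :
    (IsUnit (1 + (C : ZMod (q ^ 2)) * j) ↔ ¬ (q : ℤ) ∣ 1 + (j.val : ℤ) * C) ∧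
      (IsUnit (1 + (C : ZMod (q ^ 2)) * j) → (1 + (C : ZMod (q ^ 2)) * j) * ((h' j : ℤ) : ZMod (q ^ 2)) = j) := by
  have hcast : ((1 + (j.val : ℤ) * C : ℤ) : ZMod (q ^ 2)) = 1 + (C : ZMod (q ^ 2)) * j := by
    push_cast; rw [ZMod.natCast_zmod_val]; ring
  have hiff : IsUnit (1 + (C : ZMod (q ^ 2)) * j) ↔ ¬ (q : ℤ) ∣ 1 + (j.val : ℤ) * C := by
    rw [← hcast]; exact isUnit_intCast_iff_not_dvd q _
  refine ⟨hiff, fun hu ↦ ?_⟩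
  have h := congrArg (fun z : ℤ ↦ (z : ZMod (q ^ 2))) (hhe j (hiff.mp hu))
  push_cast at h
  have h0 : (q : ZMod (q ^ 2)) ^ 2 = 0 := by
    have := natCast_mul_natCast_sq_eq_zero q
    rwa [← sq] at this
  rw [ZMod.natCast_zmod_val, h0, zero_mul, add_zero] at h
  linear_combination h

/-- The phase of T8-2/3 in additive-character form: `cexp(2πi (y/q²) n) = ψ_{q²}(n·y)`. -/
theorem cexp_div_sq_mul_natCast (y : ℤ) (n : ℕ) :
    cexp (2 * π * I * ((y : ℂ) / (q : ℂ) ^ 2) * n) = ZMod.stdAddChar ((n : ZMod (q ^ 2)) * ((y : ℤ) : ZMod (q ^ 2))) := by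
  rw [show (n : ZMod (q ^ 2)) * ((y : ℤ) : ZMod (q ^ 2)) = (((n : ℤ) * y : ℤ) : ZMod (q ^ 2)) by push_cast; ring,
    ZMod.stdAddChar_coe]
  congr 1
  push_cast
  ring

/-- **The lower-unipotent weight of T8-2/3 vanishes off the `q`-progression.** In w5 g8's `S'(n)` shape with the single-class
weights `h j = ψ_{q²}(−β j)`, `β = q·v`: for `q ∤ n`,
`∑_{j : q ∤ 1 + j·C} ψ_{q²}(−β j)·cexp(2πi (h'_j/q²) n) = 0`. -/
theorem lowerUnipotentMoment_cexp_eq_zero_of_not_dvd (C : ℤ) (hC : ¬ (q : ℤ) ∣ C) (v : ℤ) (h' e : ZMod (q ^ 2) → ℤ)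
    (hhe : ∀ j : ZMod (q ^ 2), ¬ (q : ℤ) ∣ 1 + (j.val : ℤ) * C →
      (1 + (j.val : ℤ) * C) * h' j = (j.val : ℤ) + (q : ℤ) ^ 2 * e j) {n : ℕ} (hn : ¬ q ∣ n) :
    ∑ j : ZMod (q ^ 2), (if (q : ℤ) ∣ 1 + (j.val : ℤ) * C then (0 : ℂ) else
        ZMod.stdAddChar (-((((q : ℤ) * v : ℤ)) : ZMod (q ^ 2)) * j) *
          cexp (2 * π * I * ((h' j : ℂ) / (q : ℂ) ^ 2) * n)) = 0 := by
  classical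
  set t : (ZMod (q ^ 2))ˣ := ((isUnit_intCast_iff_not_dvd q C).mpr hC).unit with htdef
  have ht : (t : ZMod (q ^ 2)) = (C : ZMod (q ^ 2)) := IsUnit.unit_spec _
  have hn' : IsUnit ((n : ℕ) : ZMod (q ^ 2)) :=
    (ZMod.isUnit_natCast_iff_not_dvd_pow (Fact.out : q.Prime) two_pos).mpr hn
  have key := lowerUnipotentMoment_eq_zero q t ((v : ℤ) : ZMod (q ^ 2)) hn'
    (fun j ↦ ((h' j : ℤ) : ZMod (q ^ 2))) (fun j hj ↦ by
      rw [ht] at hj ⊢; exact (lowerUnipotent_data_cast q C h' e hhe j).2 hj)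
  refine (Finset.sum_congr rfl fun j _ ↦ ?_).trans key
  have hd := (lowerUnipotent_data_cast q C h' e hhe j).1
  rw [← ht] at hd
  by_cases hj : (q : ℤ) ∣ 1 + (j.val : ℤ) * C
  · rw [if_pos hj, if_neg (fun hu ↦ hd.mp hu hj)]
  · rw [if_neg hj, if_pos (hd.mpr hj), cexp_div_sq_mul_natCast]
    push_cast
    ring_nf

/-- **The lower-unipotent weight of T8-2/3 on the `q`-progression.** In w5 g8's `S'(n)` shape with `h j = ψ_{q²}(−β j)`,
`β = q·v`, at `n = q·u`, and `t` the unit of `ZMod (q²)` with `t = C`: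
`∑_{j : q ∤ 1 + j·C} ψ_{q²}(−β j)·cexp(2πi (h'_j/q²)·(q u)) = ψ_{q²}(t⁻¹·(q v + q u)) · q · K_s(u, v)`, `s = −π(t⁻¹)`,
`K_s(u,v) = ∑_{x₀ ≠ 0} ψ_q(s·(u·x₀⁻¹ + v·x₀))` (w3 g19's spelling; `π : ZMod (q²) → ZMod q`). -/
theorem lowerUnipotentMoment_cexp_mul_eq (C : ℤ) (t : (ZMod (q ^ 2))ˣ) (ht : (t : ZMod (q ^ 2)) = (C : ZMod (q ^ 2)))
    (v : ℤ) (h' e : ZMod (q ^ 2) → ℤ)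
    (hhe : ∀ j : ZMod (q ^ 2), ¬ (q : ℤ) ∣ 1 + (j.val : ℤ) * C →
      (1 + (j.val : ℤ) * C) * h' j = (j.val : ℤ) + (q : ℤ) ^ 2 * e j) (u : ℕ) :
    ∑ j : ZMod (q ^ 2), (if (q : ℤ) ∣ 1 + (j.val : ℤ) * C then (0 : ℂ) else
        ZMod.stdAddChar (-((((q : ℤ) * v : ℤ)) : ZMod (q ^ 2)) * j) *
          cexp (2 * π * I * ((h' j : ℂ) / (q : ℂ) ^ 2) * ((q * u : ℕ) : ℂ))) =
      ZMod.stdAddChar (((t⁻¹ : (ZMod (q ^ 2))ˣ) : ZMod (q ^ 2)) *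
          ((q : ZMod (q ^ 2)) * ((v : ℤ) : ZMod (q ^ 2)) + (q : ZMod (q ^ 2)) * (u : ZMod (q ^ 2)))) *
        ((q : ℂ) * ∑ x₀ : ZMod q, (if x₀ = 0 then (0 : ℂ) else
          ZMod.stdAddChar (-(ZMod.castHom (dvd_pow_self q two_ne_zero) (ZMod q)
              ((t⁻¹ : (ZMod (q ^ 2))ˣ) : ZMod (q ^ 2))) *
            ((u : ZMod q) * x₀⁻¹ + ((v : ℤ) : ZMod q) * x₀)))) := by
  classical
  have key := lowerUnipotentMoment_eq_kloosterman q t ((v : ℤ) : ZMod (q ^ 2)) (u : ZMod (q ^ 2))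
    (fun j ↦ ((h' j : ℤ) : ZMod (q ^ 2))) (fun j hj ↦ by
      rw [ht] at hj ⊢; exact (lowerUnipotent_data_cast q C h' e hhe j).2 hj)
  rw [map_natCast, map_intCast] at key
  refine (Finset.sum_congr rfl fun j _ ↦ ?_).trans key
  have hd := (lowerUnipotent_data_cast q C h' e hhe j).1
  rw [← ht] at hd
  by_cases hj : (q : ℤ) ∣ 1 + (j.val : ℤ) * C
  · rw [if_pos hj, if_neg (fun hu ↦ hd.mp hu hj)]
  · rw [if_neg hj, if_pos (hd.mpr hj), cexp_div_sq_mul_natCast]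
    push_cast
    ring_nf

end LowerUnipotent

end Summit.BirchSwinnertonDyer.BirchSwinnertonDyer.Theorems.PrintCFram.FlipRung

end
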